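import Literature.Computability.QuantumComplexity.BosonSamplingHardness
import Literature.Computability.Complexity.OracleCompositionMachine
import HarnessLib

/-!
# Discharge of `PRel_subset_PRel_of_mem_FPRel` (`f ∈ FP^O ⟹ P^f ⊆ P^O`)

Sibling proof file of `BosonSamplingHardness.lean` (D-0014: named facts `def X : Prop` are
discharged as `theorem X_holds : X`). The fact `Literature.Computability.QuantumComplexity.PRel_subset_PRel_of_mem_FPRel`
— oracle-machine composition in the transcript model of `Oracle.lean`, Arora–Barak 2009,
Example 3.6 (2) with Remark 3.8, relativised and for function oracles — is the theorem
`Literature.Computability.Complexity.OracleAlg.PRel_subset_PRel_of_mem_FPRel` of `OracleCompositionMachine.lean`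
(replay of the outer machine with the inner `FP^O`-machine answering its queries,
`OracleComposition.lean`; polynomial running time of the composite step function,
`OracleCompositionMachine.lean`). With it, the corrected form of Aaronson–Arkhipov's
"P^#P ⊆ BPP^NP from an approximate BosonSampling sampler"
(`PSharpP_subset_BPPRelClass_NP_of_uniformApproxBosonSampling_of_facts`) depends on the single
remaining literature fact `gpeSolvableInFBPPRel_NP_of_uniformApproxBosonSampling`
(Aaronson–Arkhipov 2013, Thm. 1.3 / Cor. 5.9).

## References

* S. Arora, B. Barak, *Computational Complexity: A Modern Approach*, CUP 2009, §3.4,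
  Example 3.6 (2), Remark 3.8, Claim 1.6.
* R. E. Ladner, N. A. Lynch, A. L. Selman, *A comparison of polynomial time reducibilities*,
  Theoret. Comput. Sci. 1 (1975), §2.
* S. Aaronson, A. Arkhipov, *The computational complexity of linear optics*, Theory of
  Computing 9 (2013), §4 (the oracle-access conventions this fact serves).
-/

namespace Literature.Computability.QuantumComplexity

open Complexity

/-- **Discharge of the named fact `PRel_subset_PRel_of_mem_FPRel`**: `f ∈ FP^O ⟹ P^f ⊆ P^O`
(polynomial-time oracle machines compose; Arora–Barak 2009, Example 3.6 (2) with Remark 3.8,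
relativised, function oracles), by `OracleAlg.PRel_subset_PRel_of_mem_FPRel`.
[cite: AroraBarak2009, §3.4 Example 3.6 (2) with Remark 3.8] -/
theorem PRel_subset_PRel_of_mem_FPRel_holds : PRel_subset_PRel_of_mem_FPRel :=
  fun _ _ hf => OracleAlg.PRel_subset_PRel_of_mem_FPRel hf

/-- Hence the corrected Aaronson–Arkhipov chain needs only the AA13 fact (Thm. 1.3 / Cor. 5.9) and
the Permanent-of-Gaussians Conjecture: `PGC_rand →` (`|GPE|²_± ∈ FBPP^NP` from a uniform
approximate sampler) `→ P^#P ⊆ BPP^NP`. [cite: AaronsonArkhipovToC2013, Thm. 1.3 and Cor. 5.9] -/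
theorem PSharpP_subset_BPPRelClass_NP_of_uniformApproxBosonSampling_of_fact
    (hF1 : gpeSolvableInFBPPRel_NP_of_uniformApproxBosonSampling) :
    PSharpP_subset_BPPRelClass_NP_of_uniformApproxBosonSampling :=
  PSharpP_subset_BPPRelClass_NP_of_uniformApproxBosonSampling_of_facts hF1
    PRel_subset_PRel_of_mem_FPRel_holds

end Literature.Computability.QuantumComplexity
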